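import Literature.AlgebraicGeometry.Hu2025.Statements.S01S09Interface.R110gSetupPrinted
import HarnessLib

/-!
# [Hu22] p.132 l.43–51 / row 110 g: the split torus `O × 𝔾^k_m` (`splitTorusOver k O`) over an AFFINE base `O = Spec R` IS
# `Spec (R[t₁, …, t_k][1/∏ tᵢ])`, compatibly with the projection (bridge lemma for the torsor records of HU-R01 — OURS)

**HONEST FRAMING (D-0012/D-0089).** [Hu2022] (arXiv:2203.03842v4) / [Hu2025] (arXiv:2507.21400v1) are unrefereed preprints under
adjudication; nothing of them is asserted. Row 110 g (res-type-024, `R110gSetupPrinted`) renders «(9.4) `Gr_d|_O ≅ O × (𝔾ⁿ_m/𝔾_m)` …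
`(𝔾ⁿ_m/𝔾_m) ≅ 𝔾^{n−1}_m = Spec 𝔽[s^±_1, ⋯, s^±_{n−1}]`» ([Hu22] p.132 l.43–51) as `splitTorusOver k O` = the basic open
`{∏ᵢ sᵢ ≠ 0}` of Mathlib's affine space `𝔸(Fin k; O)`, with projection `splitTorusOverProj k O`. THIS FILE (OURS, generic plumbing,
no Hu content) identifies it over an affine base with the spectrum of the Laurent polynomial ring:
* `specLaurentIso R k : Spec (R[t₁..t_k][1/∏ tᵢ]) ≅ splitTorusOver k (Spec R)` (via Mathlib's `AffineSpace.SpecIso` and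
  `basicOpenIsoSpecAway`);
* `specLaurentIso_hom_proj : (specLaurentIso R k).hom ≫ splitTorusOverProj k (Spec R) = Spec (R → R[t][1/∏ tᵢ])`.
It is the bridge between the ring-level torsor isomorphism of the quad cell (`S03Pluecker/GammaQuadTorusTorsor.torsorEquiv`,
`S01S09Interface/GammaQuadHu22SetupTorsor.cellIsoLaurent`) and the `splitTorusOver` shape of the fields `quot_trivialises` /
`Hu22P132L30` of rows 110 g/h. AI proof is weaker than expert review.
-/

noncomputable section

open _root_.CategoryTheory _root_.AlgebraicGeometry

namespace Literature.AlgebraicGeometry.Hu2025.Statements.S01S09Interface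

namespace SplitTorus

open MvPolynomial

variable (R : CommRingCat.{0}) (k : ℕ)

/-- `∏ᵢ tᵢ ∈ R[t₁, …, t_k]`. OURS plumbing.
[cite: Hu2025, Thm. 9.4 p.161; [Hu22] p.132 l.43–51 («𝔾^{n−1}_m = Spec 𝔽[s^±_1, ⋯, s^±_{n−1}]»); joint J1 = GAP-LEDGER-HU row HU-R01 (unrefereed preprints under adjudication, D-0012/D-0089 — generic plumbing for OUR typed records of row 110 g/h; nothing of the sources asserted)] -/
def tProd : (CommRingCat.of (MvPolynomial (Fin k) R) : CommRingCat.{0}) := ∏ i : Fin k, (X i : MvPolynomial (Fin k) R)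

/-- **The Laurent polynomial ring `R[t₁, …, t_k][1/∏ tᵢ]`** (coordinate ring of `Spec R × 𝔾^k_m`). OURS plumbing.
[cite: Hu2025, Thm. 9.4 p.161; [Hu22] p.132 l.43–51 («𝔾^{n−1}_m = Spec 𝔽[s^±_1, ⋯, s^±_{n−1}]»); joint J1 = GAP-LEDGER-HU row HU-R01 (unrefereed preprints under adjudication, D-0012/D-0089 — generic plumbing for OUR typed records of row 110 g/h; nothing of the sources asserted)] -/
abbrev Laurent : Type := Localization.Away (tProd R k)

/-- The structure ring map `R → R[t][1/∏ tᵢ]`. OURS plumbing.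
[cite: Hu2025, Thm. 9.4 p.161; [Hu22] p.132 l.43–51; joint J1 = GAP-LEDGER-HU row HU-R01 (unrefereed preprints under adjudication, D-0012/D-0089 — generic plumbing for OUR typed records of row 110 g/h; nothing of the sources asserted)] -/
def ιR : R →+* Laurent R k := (algebraMap (MvPolynomial (Fin k) R) (Laurent R k)).comp MvPolynomial.C

/-- The basic open `D(∏ tᵢ) ⊂ Spec R[t]`. OURS plumbing.
[cite: Hu2025, Thm. 9.4 p.161; [Hu22] p.132 l.43–51; joint J1 = GAP-LEDGER-HU row HU-R01 (unrefereed preprints under adjudication, D-0012/D-0089 — generic plumbing for OUR typed records of row 110 g/h; nothing of the sources asserted)] -/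
abbrev polyBasicOpen : (Spec (CommRingCat.of (MvPolynomial (Fin k) R))).Opens := PrimeSpectrum.basicOpen (tProd R k)

/-- Under `AffineSpace.SpecIso`, the split torus pulls back to `D(∏ tᵢ)`.
[cite: Hu2025, Thm. 9.4 p.161; [Hu22] p.132 l.43–51; joint J1 = GAP-LEDGER-HU row HU-R01 (unrefereed preprints under adjudication, D-0012/D-0089 — generic plumbing for OUR typed records of row 110 g/h; nothing of the sources asserted)] -/
theorem preimage_splitTorusOver :
    (AffineSpace.SpecIso (Fin k) R).inv ⁻¹ᵁ (splitTorusOver k (Spec R)) = polyBasicOpen R k := by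
  rw [splitTorusOver, Scheme.preimage_basicOpen]
  have h : (AffineSpace.SpecIso (Fin k) R).inv.app ⊤ (∏ i : Fin k, AffineSpace.coord (Spec R) i) =
      (Scheme.ΓSpecIso (CommRingCat.of (MvPolynomial (Fin k) R))).inv (tProd R k) := by
    show (AffineSpace.SpecIso (Fin k) R).inv.appTop (∏ i : Fin k, AffineSpace.coord (Spec R) i) = _
    rw [map_prod, tProd, map_prod]
    exact Finset.prod_congr rfl fun i _ => AffineSpace.SpecIso_inv_appTop_coord R i
  rw [h]
  exact basicOpen_eq_of_affine _

/-- The range of `D(∏ tᵢ) ↪ Spec R[t] ≅ 𝔸(Fin k; Spec R)` is the split torus.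
[cite: Hu2025, Thm. 9.4 p.161; [Hu22] p.132 l.43–51; joint J1 = GAP-LEDGER-HU row HU-R01 (unrefereed preprints under adjudication, D-0012/D-0089 — generic plumbing for OUR typed records of row 110 g/h; nothing of the sources asserted)] -/
theorem range_ι_SpecIso_inv :
    Set.range ⇑((polyBasicOpen R k).ι ≫ (AffineSpace.SpecIso (Fin k) R).inv) =
      ((splitTorusOver k (Spec R) : (𝔸(Fin k; Spec R)).Opens) : Set _) := by
  have hc : ⇑((polyBasicOpen R k).ι ≫ (AffineSpace.SpecIso (Fin k) R).inv) =
      ⇑(AffineSpace.SpecIso (Fin k) R).inv ∘ ⇑(polyBasicOpen R k).ι :=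
    funext fun x => Scheme.Hom.comp_apply _ _ x
  rw [hc, Set.range_comp, Scheme.Opens.range_ι, ← preimage_splitTorusOver, Scheme.Hom.coe_preimage,
    Set.image_preimage_eq]
  exact (AffineSpace.SpecIso (Fin k) R).inv.homeomorph.surjective

/-- `D(∏ tᵢ) ≅ splitTorusOver k (Spec R)` over `𝔸(Fin k; Spec R)`. OURS plumbing.
[cite: Hu2025, Thm. 9.4 p.161; [Hu22] p.132 l.43–51; joint J1 = GAP-LEDGER-HU row HU-R01 (unrefereed preprints under adjudication, D-0012/D-0089 — generic plumbing for OUR typed records of row 110 g/h; nothing of the sources asserted)] -/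
def basicOpenIsoSplitTorus : ((polyBasicOpen R k : (Spec (CommRingCat.of (MvPolynomial (Fin k) R))).Opens) : Scheme.{0}) ≅
    ((splitTorusOver k (Spec R) : (𝔸(Fin k; Spec R)).Opens) : Scheme.{0}) :=
  IsOpenImmersion.isoOfRangeEq ((polyBasicOpen R k).ι ≫ (AffineSpace.SpecIso (Fin k) R).inv) (splitTorusOver k (Spec R)).ι
    (by rw [range_ι_SpecIso_inv, Scheme.Opens.range_ι])

/-- `basicOpenIsoSplitTorus.hom ≫ ι = ι ≫ SpecIso.inv`.
[cite: Hu2025, Thm. 9.4 p.161; [Hu22] p.132 l.43–51; joint J1 = GAP-LEDGER-HU row HU-R01 (unrefereed preprints under adjudication, D-0012/D-0089 — generic plumbing for OUR typed records of row 110 g/h; nothing of the sources asserted)] -/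
theorem basicOpenIsoSplitTorus_hom_ι :
    (basicOpenIsoSplitTorus R k).hom ≫ (splitTorusOver k (Spec R)).ι =
      (polyBasicOpen R k).ι ≫ (AffineSpace.SpecIso (Fin k) R).inv :=
  IsOpenImmersion.isoOfRangeEq_hom_fac _ _ _

/-- **`specLaurentIso R k : Spec (R[t₁..t_k][1/∏ tᵢ]) ≅ splitTorusOver k (Spec R)`** — the split torus of row 110 g over an affine
base is the spectrum of the Laurent polynomial ring. OURS plumbing (no Hu content).
[cite: Hu2025, Thm. 9.4 p.161; [Hu22] p.132 l.43–51 («(9.4) Gr_d|_O ≅ O × (𝔾ⁿ_m/𝔾_m) … 𝔾^{n−1}_m = Spec 𝔽[s^±_1, ⋯, s^±_{n−1}]»); joint J1 = GAP-LEDGER-HU row HU-R01 (unrefereed preprints under adjudication, D-0012/D-0089 — generic plumbing for OUR typed records of row 110 g/h; nothing of the sources asserted)] -/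
def specLaurentIso : Spec (CommRingCat.of (Laurent R k)) ≅ ((splitTorusOver k (Spec R) : (𝔸(Fin k; Spec R)).Opens) : Scheme.{0}) :=
  (basicOpenIsoSpecAway (R := CommRingCat.of (MvPolynomial (Fin k) R)) (tProd R k)).symm ≪≫ basicOpenIsoSplitTorus R k

/-- **Compatibility with the projection**: `specLaurentIso.hom ≫ splitTorusOverProj = Spec (R → R[t][1/∏ tᵢ])`.
[cite: Hu2025, Thm. 9.4 p.161; [Hu22] p.132 l.43–51 («(9.4) Gr_d|_O ≅ O × (𝔾ⁿ_m/𝔾_m)»); joint J1 = GAP-LEDGER-HU row HU-R01 (unrefereed preprints under adjudication, D-0012/D-0089 — generic plumbing for OUR typed records of row 110 g/h; nothing of the sources asserted)] -/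
theorem specLaurentIso_hom_proj :
    (specLaurentIso R k).hom ≫ splitTorusOverProj k (Spec R) = Spec.map (CommRingCat.ofHom (ιR R k)) := by
  have h1 : (basicOpenIsoSplitTorus R k).hom ≫ splitTorusOverProj k (Spec R) =
      (polyBasicOpen R k).ι ≫ Spec.map (CommRingCat.ofHom (MvPolynomial.C : R →+* MvPolynomial (Fin k) R)) := by
    rw [splitTorusOverProj, ← Category.assoc, basicOpenIsoSplitTorus_hom_ι, Category.assoc, AffineSpace.SpecIso_inv_over]
  have h2 : (basicOpenIsoSpecAway (R := CommRingCat.of (MvPolynomial (Fin k) R)) (tProd R k)).inv ≫ (polyBasicOpen R k).ι =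
      Spec.map (CommRingCat.ofHom (algebraMap (MvPolynomial (Fin k) R) (Laurent R k))) := by
    rw [Iso.inv_comp_eq]
    exact (basicOpenIsoSpecAway_hom_SpecMap _).symm
  show ((basicOpenIsoSpecAway (R := CommRingCat.of (MvPolynomial (Fin k) R)) (tProd R k)).inv ≫
      (basicOpenIsoSplitTorus R k).hom) ≫ splitTorusOverProj k (Spec R) = _
  rw [Category.assoc, h1, ← Category.assoc, h2, ← Spec.map_comp, ← CommRingCat.ofHom_comp]
  rfl

end SplitTorus

end Literature.AlgebraicGeometry.Hu2025.Statements.S01S09Interface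

end
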